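import Summits.ResolutionOfSingularities.ResolutionOfSingularities.Theorems.HomologicalConductorSurfaceTerminationGenusTwoRegular
import HarnessLib

/-!
# Kill test `SurfaceTermination` / W4.4 support programme «P_G LERAY»: the `Lipman1969_1_2`-FREE siblings of the
# Genus-line lemmas over REGULAR surfaces (consumer swap after the F-79 «2-reg» theorem)

Route `ResolutionOfSingularities/HomologicalConductor`, crux chain W4.4 (supports
stmt-ResolutionOfSingularities-19943); INPUTS-v5 TOP-10 #2 «consumer swap» of the D-0154 (2) RES inputs cell.
OURS (cell res-hironaka; text = res-inputs-plan-1 g8's checked scratch `F79_2reg_CONSUMER_SIBLINGS_scratch.lean`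
20ff9a2e516f28bb, filed by res-inputs-p-9c g3; critic R97/R100: NEW sibling decls only, the originals untouched,
V35-side re-plumbing at the desk's timing); AI-written, weaker than expert review; nothing of the manuscript under
review (Hironaka 2017) is used.

The seven Genus-line decls whose ONLY live printed input was the named fact `Lipman1969_1_2` — consumed solely at
`GenusDescent.hasTrivialCechH1_pullback_snd_fromSpecStalk` (`…GenusLocalResolution`) for a REGULAR two-dimensional
stalk — get `h12`-FREE siblings here, now that Lipman (1.2) 2) for a regular base is the tree theorem
`SurfaceTermination.TwoRegular.hasTrivialCechH1_of_isResolution_of_isRegularLocalRing` (`…GenusTwoRegular`):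
1 `TwoRegular.hasTrivialCechH1_pullback_snd_fromSpecStalk` (sibling of `…GenusLocalResolution` :115) ·
2 `TwoRegular.cechZ1_le_cechB1_chart` (`…GenusDomination` :153) ·
3 `TwoRegular.cechRefineH1_comp_cechComapH1_surjective` (:339) · 4 `TwoRegular.length_cechH1_le_of_dominates` (:367) ·
5 `TwoRegular.length_cechH1_le_of_dominates_of_bound` (`…GenusChart` :131) ·
6 `TwoRegular.hasGeometricGenusLE_of_chart_of_isProjectiveOverRing` (`…GenusChart` :324; now print-free end to end:
no (1.2), no Görtz–Wedhorn 24.44) · 7 `TwoRegular.cechZ1_le_cechB1_chart_of_forall_mem` (`…ChartVanishing` :45).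
Each sibling's STATEMENT is the original's with the binder `(h12 : Lipman1969_1_2.{0})` deleted and nothing else
changed; siblings 1–4 and 7 are one-liners over the pointwise lemmas of `…GenusTwoRegularLeray`
(`hasTrivialCechH1_pullback_snd_fromSpecStalk_of_dimTwo`, `cechZ1_le_cechB1_chart_of_forall_stalk_mem`,
`cechRefineH1_comp_cechComapH1_surjective_of_forall_stalk`); siblings 5–6 are the `…GenusChart` bodies verbatim with
the one domination call re-pointed.  The decls live in the sub-namespace `GenusDescent.TwoRegular` (the assembly's
two theorems live in `SurfaceTermination.TwoRegular`; no clash).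

HONEST SCOPE: `Lipman1969_1_2` in general (rational NON-regular base; part 1)) STAYS PRINT — its other binders
(RationalPropagation, StageRational, NoZeno*, and the three shared Genus-line decls `hasGeometricGenusLE_of_chart`
/ `_of_chart'` / `_tower_succ_succ`, which only thread `h12` to the decls below) are NOT served by 2-reg;
`GortzWedhorn2023_24_44_H2` general STAYS PRINT; no summit statement is proved; resolution in dim ≥ 4 / char p
is NOT proved.

References: J. Lipman, Publ. IHÉS 36 (1969), Prop. (1.2) [`Lipman1969`]; EGA III₁ (1.4.15) [`EGAIII1`];
U. Görtz, T. Wedhorn II, Cor. 21.82, Cor. 24.44 [`GortzWedhorn2023`].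
-/

set_option linter.dupNamespace false

noncomputable section

open CategoryTheory CategoryTheory.Limits AlgebraicGeometry TopologicalSpace IsLocalRing
open Literature.AlgebraicGeometry.Resolution Literature.AlgebraicGeometry.Morphisms
open Literature.AlgebraicGeometry.Morphisms.CechLocalization
open Summit.ResolutionOfSingularities.ResolutionOfSingularities.Theorems
open Summit.ResolutionOfSingularities.ResolutionOfSingularities.Theorems.NoZeno.SandwichCluster

namespace Summit.ResolutionOfSingularities.ResolutionOfSingularities.Theorems.SurfaceTermination.GenusDescent

section Pointwise

variable {X Z : Scheme.{0}} [IsIntegral X] [NoetherianSpace X] [NoetherianSpace Z]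
  (ρ : Z ⟶ X) [IsProper ρ] (x : X)

/-- **`Ȟ¹ = 0` on the base change of a proper birational `ρ : Z → X` (`Z` regular) to `Spec 𝒪_{X,x}` at a REGULAR
point `x` of dimension `≤ 2`** — the `Lipman1969_1_2`-free sibling of
`GenusDescent.hasTrivialCechH1_pullback_snd_fromSpecStalk`: the dimension-two case is the tree theorem
`SurfaceTermination.TwoRegular.hasTrivialCechH1_of_isResolution_of_isRegularLocalRing` (Lipman (1.2) 2) for a regular
base), the dimension `≤ 1` case is affine. [cite: Lipman1969, Proposition (1.2) 2) (p. 199)] -/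
theorem TwoRegular.hasTrivialCechH1_pullback_snd_fromSpecStalk (hρ : IsBirational ρ)
    (hZ : Scheme.IsRegular Z) (hx : IsRegularLocalRing (X.presheaf.stalk x))
    (hdim : ringKrullDim (X.presheaf.stalk x) ≤ 2) :
    HasTrivialCechH1 (pullback.snd ρ (X.fromSpecStalk x)) :=
  hasTrivialCechH1_pullback_snd_fromSpecStalk_of_dimTwo ρ x hρ hZ hx hdim fun h2 => by
    haveI := hx
    exact SurfaceTermination.TwoRegular.hasTrivialCechH1_of_isResolution_of_isRegularLocalRing h2 _
      (isResolution_pullback_snd_fromSpecStalk ρ x hρ hZ).1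

end Pointwise

section Chart

variable {T : Type} [CommRing T] {X Z : Scheme.{0}} [IsIntegral X] [NoetherianSpace X]
  [NoetherianSpace Z] (πX : X ⟶ Spec (.of T)) (ρ : Z ⟶ X) [IsProper ρ]

/-- **Chartwise `R¹ρ_*𝒪_Z = 0`** for `ρ : Z → X` proper birational, `Z` regular, `X` regular with local rings of
dimension `≤ 2`, over an affine open `U ⊆ X` — the `Lipman1969_1_2`-free sibling of `GenusDescent.cechZ1_le_cechB1_chart`
(through `cechZ1_le_cechB1_chart_of_forall_stalk_mem`). [cite: EGAIII1, Prop. (1.4.15)] -/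
theorem TwoRegular.cechZ1_le_cechB1_chart (hρ : IsBirational ρ)
    (hZ : Scheme.IsRegular Z) (hX : Scheme.IsRegular X)
    (hdimX : ∀ x : X, ringKrullDim (X.presheaf.stalk x) ≤ 2) {U : X.Opens} (hU : IsAffineOpen U)
    {κ : Type} [Finite κ] (G : κ → Z.Opens) (hGcov : ⨆ j, G j = ρ ⁻¹ᵁ U)
    (hG : ∀ j, IsAffineOpen (G j)) (hG2 : ∀ j j', IsAffineOpen (G j ⊓ G j'))
    (hG3 : ∀ j j' j'', IsAffineOpen (G j ⊓ G j' ⊓ G j'')) :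
    cechZ1 (ρ ≫ πX) G ≤ cechB1 (ρ ≫ πX) G :=
  cechZ1_le_cechB1_chart_of_forall_stalk_mem πX ρ
    (fun x _ => TwoRegular.hasTrivialCechH1_pullback_snd_fromSpecStalk ρ x hρ hZ (hX x) (hdimX x))
    hU G hGcov hG hG2 hG3

/-- **Chartwise `R¹ρ_*𝒪_Z = 0` over an affine open of REGULAR points of dimension `≤ 2`** — the
`Lipman1969_1_2`-free sibling of `GenusDescent.cechZ1_le_cechB1_chart_of_forall_mem` (through
`cechZ1_le_cechB1_chart_of_forall_stalk_mem`). [cite: EGAIII1, Prop. (1.4.15)] -/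
theorem TwoRegular.cechZ1_le_cechB1_chart_of_forall_mem (hρ : IsBirational ρ)
    (hZ : Scheme.IsRegular Z) {U : X.Opens} (hU : IsAffineOpen U)
    (hX : ∀ x ∈ U, IsRegularLocalRing (X.presheaf.stalk x))
    (hdimX : ∀ x ∈ U, ringKrullDim (X.presheaf.stalk x) ≤ 2)
    {κ : Type} [Finite κ] (G : κ → Z.Opens) (hGcov : ⨆ j, G j = ρ ⁻¹ᵁ U)
    (hG : ∀ j, IsAffineOpen (G j)) (hG2 : ∀ j j', IsAffineOpen (G j ⊓ G j'))
    (hG3 : ∀ j j' j'', IsAffineOpen (G j ⊓ G j' ⊓ G j'')) :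
    cechZ1 (ρ ≫ πX) G ≤ cechB1 (ρ ≫ πX) G :=
  cechZ1_le_cechB1_chart_of_forall_stalk_mem πX ρ
    (fun x hx => TwoRegular.hasTrivialCechH1_pullback_snd_fromSpecStalk ρ x hρ hZ (hX x hx) (hdimX x hx))
    hU G hGcov hG hG2 hG3

end Chart

section Leray

variable {T : Type} [CommRing T] {X Z : Scheme.{0}} [IsIntegral X] [IsIntegral Z] [NoetherianSpace X]
  [NoetherianSpace Z] (πX : X ⟶ Spec (.of T)) (ρ : Z ⟶ X) [IsProper ρ]

/-- **Leray in degree one along a domination of regular surfaces: `Ȟ¹(𝒰, 𝒪_X) ↠ Ȟ¹(𝒲, 𝒪_Z)`** — the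
`Lipman1969_1_2`-free sibling of `GenusDescent.cechRefineH1_comp_cechComapH1_surjective` (through
`cechRefineH1_comp_cechComapH1_surjective_of_forall_stalk`). [cite: GortzWedhorn2023, Cor. 21.82 (p. 265)] -/
theorem TwoRegular.cechRefineH1_comp_cechComapH1_surjective (hρ : IsBirational ρ)
    (hZ : Scheme.IsRegular Z) (hX : Scheme.IsRegular X)
    (hdimX : ∀ x : X, ringKrullDim (X.presheaf.stalk x) ≤ 2)
    {ι : Type} [Finite ι] (U : ι → X.Opens) (hU : ∀ i, IsAffineOpen (U i))
    {κ : Type} [Finite κ] (W : κ → Z.Opens) (hWcov : ⨆ j, W j = ⊤) (τ : κ → ι)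
    (hτ : ∀ j, W j ≤ ρ ⁻¹ᵁ U (τ j)) (hUW : ∀ i j, IsAffineOpen (ρ ⁻¹ᵁ U i ⊓ W j))
    (hUW2 : ∀ i j j', IsAffineOpen (ρ ⁻¹ᵁ U i ⊓ W j ⊓ (ρ ⁻¹ᵁ U i ⊓ W j')))
    (hUW3 : ∀ i j j' j'',
      IsAffineOpen (ρ ⁻¹ᵁ U i ⊓ W j ⊓ (ρ ⁻¹ᵁ U i ⊓ W j') ⊓ (ρ ⁻¹ᵁ U i ⊓ W j''))) :
    Function.Surjective
      (cechRefineH1 (ρ ≫ πX) (preimageFamily ρ U) W τ hτ ∘ₗ cechComapH1 πX (ρ ≫ πX) ρ rfl U) :=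
  cechRefineH1_comp_cechComapH1_surjective_of_forall_stalk πX ρ hρ hX
    (fun x => TwoRegular.hasTrivialCechH1_pullback_snd_fromSpecStalk ρ x hρ hZ (hX x) (hdimX x))
    U hU W hWcov τ hτ hUW hUW2 hUW3

/-- **The geometric genus does not grow under domination** (`length_T Ȟ¹(𝒲, 𝒪_Z) ≤ length_T Ȟ¹(𝒰, 𝒪_X)`) — the
`Lipman1969_1_2`-free sibling of `GenusDescent.length_cechH1_le_of_dominates`. [cite: GortzWedhorn2023, Cor. 21.82 (p. 265)] -/
theorem TwoRegular.length_cechH1_le_of_dominates (hρ : IsBirational ρ)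
    (hZ : Scheme.IsRegular Z) (hX : Scheme.IsRegular X)
    (hdimX : ∀ x : X, ringKrullDim (X.presheaf.stalk x) ≤ 2)
    {ι : Type} [Finite ι] (U : ι → X.Opens) (hU : ∀ i, IsAffineOpen (U i))
    {κ : Type} [Finite κ] (W : κ → Z.Opens) (hWcov : ⨆ j, W j = ⊤) (τ : κ → ι)
    (hτ : ∀ j, W j ≤ ρ ⁻¹ᵁ U (τ j)) (hUW : ∀ i j, IsAffineOpen (ρ ⁻¹ᵁ U i ⊓ W j))
    (hUW2 : ∀ i j j', IsAffineOpen (ρ ⁻¹ᵁ U i ⊓ W j ⊓ (ρ ⁻¹ᵁ U i ⊓ W j')))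
    (hUW3 : ∀ i j j' j'',
      IsAffineOpen (ρ ⁻¹ᵁ U i ⊓ W j ⊓ (ρ ⁻¹ᵁ U i ⊓ W j') ⊓ (ρ ⁻¹ᵁ U i ⊓ W j''))) :
    Module.length T (CechH1 (ρ ≫ πX) W) ≤ Module.length T (CechH1 πX U) :=
  Module.length_le_of_surjective _ (TwoRegular.cechRefineH1_comp_cechComapH1_surjective πX ρ hρ hZ hX
    hdimX U hU W hWcov τ hτ hUW hUW2 hUW3)

end Leray

/-- **Domination step with the bound**: for a resolution `ξ : X → Spec T` (`dim T ≤ 2`) with `ℓ_T Ȟ¹(𝒰_X) ≤ g` for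
all finite affine covers and a regular `Z` with a proper birational `τ : Z → X`, `ℓ_T Ȟ¹(𝒰, 𝒪_Z) ≤ g` for every
finite affine cover `𝒰` of `Z` — the `Lipman1969_1_2`-free sibling of `GenusDescent.length_cechH1_le_of_dominates_of_bound`
(same proof, the domination call re-pointed at `TwoRegular.length_cechH1_le_of_dominates`).
[cite: GortzWedhorn2023, Cor. 21.82 (p. 265)] -/
theorem TwoRegular.length_cechH1_le_of_dominates_of_bound
    {T : Type} [CommRing T] [IsDomain T] [IsNoetherianRing T] [IsLocalRing T]
    (hdimT : ringKrullDim T ≤ 2)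
    {X : Scheme.{0}} (ξ : X ⟶ Spec (.of T)) (hξ : IsResolution ξ) (g : ℕ)
    (hbound : ∀ (ι : Type) [Finite ι] (U : ι → X.Opens), (∀ i, IsAffineOpen (U i)) →
      ⨆ i, U i = ⊤ → Module.length T (CechH1 ξ U) ≤ (g : ℕ∞))
    {Z : Scheme.{0}} (τ : Z ⟶ X) [IsProper τ] (hτ : IsBirational τ) (hZreg : Scheme.IsRegular Z)
    {ι : Type} [Finite ι] (U : ι → Z.Opens) (hUaff : ∀ i, IsAffineOpen (U i)) (hUcov : ⨆ i, U i = ⊤) :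
    Module.length T (CechH1 (τ ≫ ξ) U) ≤ (g : ℕ∞) := by
  classical
  haveI : IsProper ξ := hξ.isProper
  haveI : IsDomain (CommRingCat.of T) := ‹IsDomain T›
  haveI : IsNoetherianRing (CommRingCat.of T) := ‹IsNoetherianRing T›
  haveI : IsIntegral X := hξ.isIntegral_source
  have hfZres : IsResolution (τ ≫ ξ) := ⟨inferInstance, hτ.comp hξ.isBirational, hZreg⟩
  haveI : IsIntegral Z := hfZres.isIntegral_source
  haveI : IsLocallyNoetherian Z := LocallyOfFiniteType.isLocallyNoetherian (τ ≫ ξ)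
  haveI : CompactSpace Z := QuasiCompact.compactSpace_of_compactSpace (τ ≫ ξ)
  haveI : IsNoetherian Z := {}
  haveI : IsLocallyNoetherian X := LocallyOfFiniteType.isLocallyNoetherian ξ
  haveI : CompactSpace X := QuasiCompact.compactSpace_of_compactSpace ξ
  haveI : IsNoetherian X := {}
  haveI : Z.IsSeparated := ⟨by rw [← terminal.comp_from (τ ≫ ξ)]; infer_instance⟩
  obtain ⟨ι', _, UX, hUXaff, hUXcov⟩ := exists_finite_affine_cover X
  obtain ⟨κ, _, WZ, rZ, hWZaff, hWZr, hWZcov⟩ := exists_finite_affine_refinement Z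
    (fun i => τ ⁻¹ᵁ UX i) (by rw [← Scheme.Hom.preimage_iSup, hUXcov]; exact Opens.map_top _)
  have hdimX : ∀ x : X, ringKrullDim (X.presheaf.stalk x) ≤ 2 := fun x =>
    ringKrullDim_stalk_le_two_of_isResolution hdimT hξ x
  have hUW : ∀ i j, IsAffineOpen (τ ⁻¹ᵁ UX i ⊓ WZ j) := fun i j => by
    rw [inf_comm]
    exact SeparatedAffinePreimage.isAffineOpen_inf_preimage τ ξ (hWZaff j) (hUXaff i)
  have hUW2 : ∀ i j j', IsAffineOpen (τ ⁻¹ᵁ UX i ⊓ WZ j ⊓ (τ ⁻¹ᵁ UX i ⊓ WZ j')) := by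
    intro i j j'
    rw [inf_comm (τ ⁻¹ᵁ UX i) (WZ j), inf_comm (τ ⁻¹ᵁ UX i) (WZ j'), inf_inf_inf_inf_eq]
    exact SeparatedAffinePreimage.isAffineOpen_inf_preimage τ ξ ((hWZaff j).inf (hWZaff j'))
      (hUXaff i)
  have hUW3 : ∀ i j j' j'', IsAffineOpen
      (τ ⁻¹ᵁ UX i ⊓ WZ j ⊓ (τ ⁻¹ᵁ UX i ⊓ WZ j') ⊓ (τ ⁻¹ᵁ UX i ⊓ WZ j'')) := by
    intro i j j' j''
    rw [inf_comm (τ ⁻¹ᵁ UX i) (WZ j), inf_comm (τ ⁻¹ᵁ UX i) (WZ j'), inf_comm (τ ⁻¹ᵁ UX i) (WZ j''),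
      inf_inf_inf_inf_inf_eq]
    exact SeparatedAffinePreimage.isAffineOpen_inf_preimage τ ξ
      (((hWZaff j).inf (hWZaff j')).inf (hWZaff j'')) (hUXaff i)
  calc Module.length T (CechH1 (τ ≫ ξ) U)
      = Module.length T (CechH1 (τ ≫ ξ) WZ) :=
        length_cechH1_eq_of_isAffineOpen (τ ≫ ξ) U WZ hUaff hWZaff hUcov hWZcov
    _ ≤ Module.length T (CechH1 ξ UX) :=
        TwoRegular.length_cechH1_le_of_dominates ξ τ hτ hZreg hξ.isRegular hdimX UX hUXaff WZ hWZcov rZ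
          hWZr hUW hUW2 hUW3
    _ ≤ (g : ℕ∞) := hbound ι' UX hUXaff hUXcov

/-- **Genus bound for a localised chart over a PROJECTIVE middle model, print-free**: the `Lipman1969_1_2`-free
sibling of `GenusDescent.hasGeometricGenusLE_of_chart_of_isProjectiveOverRing` (itself already free of
`GortzWedhorn2023_24_44_H2` via the projective `Ȟ²`-vanishing); same proof, the domination step re-pointed at
`TwoRegular.length_cechH1_le_of_dominates_of_bound`.  This end of the chain now uses no named fact.
[cite: GortzWedhorn2023, Cor. 24.44 (projective case)] [cite: EGAIII1, Prop. (1.4.15)] -/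
theorem TwoRegular.hasGeometricGenusLE_of_chart_of_isProjectiveOverRing
    {T : Type} [CommRing T] [IsDomain T] [IsNoetherianRing T] [IsLocalRing T]
    (hdimT : ringKrullDim T ≤ 2)
    -- the given resolution with the genus bound
    {X : Scheme.{0}} (ξ : X ⟶ Spec (.of T)) (hξ : IsResolution ξ) (g : ℕ)
    (hbound : ∀ (ι : Type) [Finite ι] (U : ι → X.Opens), (∀ i, IsAffineOpen (U i)) →
      ⨆ i, U i = ⊤ → Module.length T (CechH1 ξ U) ≤ (g : ℕ∞))
    -- a regular `Z` dominating `X`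
    {Z : Scheme.{0}} (τ : Z ⟶ X) [IsProper τ] (hτ : IsBirational τ) (hZreg : Scheme.IsRegular Z)
    -- the middle model `B` and `σ_B : Z → B` over `Spec T`
    {B : Scheme.{0}} [IsIntegral B] (gB : B ⟶ Spec (.of T)) [IsProper gB] (hgB : IsBirational gB)
    (hproj : Literature.AlgebraicGeometry.Crystalline.IsProjectiveOverRing
      (CategoryTheory.Over.mk gB : Literature.AlgebraicGeometry.Motives.SchemeOver T))
    (σB : Z ⟶ B) (hσB : σB ≫ gB = τ ≫ ξ)
    -- a finite affine cover of `B` with a distinguished member and acyclic mixed pieces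
    {α : Type} [Finite α] (W : α → B.Opens) (hW : ∀ a, IsAffineOpen (W a)) (hWcov : ⨆ a, W a = ⊤)
    (a₀ : α)
    (hvan : ∀ b, b ≠ a₀ → ∀ {κ : Type} (G : κ → Z.Opens), ⨆ j, G j = σB ⁻¹ᵁ (W a₀ ⊓ W b) →
      cechZ1 (τ ≫ ξ) G ≤ cechB1 (τ ≫ ξ) G)
    -- the chart: a resolution `σ : σ_B⁻¹(W a₀) → Spec N` over `Spec T`
    {N : Type} [CommRing N] [IsDomain N] [Algebra T N]
    (σ : ((σB ⁻¹ᵁ W a₀ : Z.Opens) : Scheme.{0}) ⟶ Spec (.of N)) (hσ : IsResolution σ)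
    (hσT : (σB ⁻¹ᵁ W a₀).ι ≫ (τ ≫ ξ) = σ ≫ Spec.map (CommRingCat.ofHom (algebraMap T N)))
    -- the localisation `T'` of `N`
    (T' : Type) [CommRing T'] [IsDomain T'] [Algebra N T'] (M : Submonoid N) [IsLocalization M T'] :
    HasGeometricGenusLE T' g := by
  classical
  haveI : IsProper ξ := hξ.isProper
  haveI : IsNoetherianRing (CommRingCat.of T) := ‹IsNoetherianRing T›
  haveI : IsLocalRing (CommRingCat.of T) := ‹IsLocalRing T›
  haveI : IsProper (τ ≫ ξ) := inferInstance
  haveI : IsLocallyNoetherian Z := LocallyOfFiniteType.isLocallyNoetherian (τ ≫ ξ)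
  haveI : CompactSpace Z := QuasiCompact.compactSpace_of_compactSpace (τ ≫ ξ)
  haveI : IsNoetherian Z := {}
  -- fibres of `B → Spec T` have dimension `≤ 1`
  have hfib : ∀ y : Spec (.of T), topologicalKrullDim (gB.fiber y) ≤ 1 :=
    topologicalKrullDim_fiber_le_one_of_isBirational hdimT hgB
  -- a finite affine cover `𝒰` of `Z` refining `σ_B⁻¹𝒲`
  obtain ⟨ι, _, U, r, hUaff, hUr, hUcov⟩ := exists_finite_affine_refinement Z
    (fun a => σB ⁻¹ᵁ W a) (by rw [← Scheme.Hom.preimage_iSup, hWcov]; exact Opens.map_top _)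
  -- GLUE over the PROJECTIVE middle model (p613816 twin; no named fact): `ℓ_T Ȟ¹((U_i ∩ V)_i) ≤ ℓ_T Ȟ¹(𝒰)`
  have hglue : Module.length T (CechH1 (τ ≫ ξ) (fun i => U i ⊓ σB ⁻¹ᵁ W a₀)) ≤
      Module.length T (CechH1 (τ ≫ ξ) U) := by
    refine length_cechH1_preimage_piece_le_of_isProjectiveOverRing gB hproj (hfib (closedPoint T)) σB (τ ≫ ξ)
      hσB W hW hWcov U r hUr hUcov a₀ fun b hb => hvan b hb _ ?_
    calc ⨆ i, U i ⊓ σB ⁻¹ᵁ W a₀ ⊓ σB ⁻¹ᵁ W b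
        = ⨆ i, U i ⊓ (σB ⁻¹ᵁ W a₀ ⊓ σB ⁻¹ᵁ W b) := by simp_rw [inf_assoc]
      _ = (⨆ i, U i) ⊓ (σB ⁻¹ᵁ W a₀ ⊓ σB ⁻¹ᵁ W b) := (iSup_inf_eq _ _).symm
      _ = σB ⁻¹ᵁ (W a₀ ⊓ W b) := by rw [hUcov, top_inf_eq, Scheme.Hom.preimage_inf]
  -- domination
  have hdom : Module.length T (CechH1 (τ ≫ ξ) U) ≤ (g : ℕ∞) :=
    TwoRegular.length_cechH1_le_of_dominates_of_bound hdimT ξ hξ g hbound τ hτ hZreg U hUaff hUcov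
  -- the chart
  obtain ⟨X', f', hf', hX'⟩ := exists_isResolution_length_cechH1_le_of_chart (τ ≫ ξ) U hUaff hUcov
    (σB ⁻¹ᵁ W a₀) (fun O hO => SeparatedAffinePreimage.isAffineOpen_inf_preimage σB gB hO (hW a₀))
    σ hσ hσT T' M
  exact ⟨X', f', hf', fun ι' _ U' hU' hU'cov =>
    ((hX' ι' U' hU' hU'cov).trans hglue).trans hdom⟩

end Summit.ResolutionOfSingularities.ResolutionOfSingularities.Theorems.SurfaceTermination.GenusDescent

end
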